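/-
Copyright (c) 2026 the pub-hodgecm-mathlib formalisation cell (harness21).  Prover seat hodgecm-mathlib-F0P3a-p01 (g34), req620 Track A «(D-RAM) FOUR-FRAME» squad, unit U2H:
the (ρ2b′-X) child (U2H ED. 15 :418) — SOCKET (C) (type RamM) organ (C-5b) Σ3c «THE RamM SIGN LAW, TYPE-FREE: THE FOUR SIDE LETTERS AND THE WINDOW» ((C) lead LH4-p04 (g5)
LINE #16; consumer ★ p858394 `toricCensusSum_ramM_weld_of_frame` binders `hST hSE hSP hSM` + `hεQ`).  2026-09-04.
-/
import Summits.HodgeConjecture.HodgeConjecture.Theorems.F0P3cDyRamSignFarCellRamM             -- Σ3a (this seat): far-cell class criterion, S9 twist factorisation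
import Summits.HodgeConjecture.HodgeConjecture.Theorems.F0P3cDyRamToricLevelCensusRamMTopCellsOdd -- ★ p858305 (LH4-p06): `bitLit_iff_twistNear_neg`
import HarnessLib

/-!
# Crux `H413`, line LH4 «(D-RAM) FOUR-FRAME» road — unit U2H, (ρ2b′-X), SOCKET (C): THE RamM SIGN LAW, TYPE-FREE (Σ3c)

Cell `hodgecm-mathlib` (D-0151), FLOOR 0, crux item H413 = `stmt-HodgeConjecture-24833`, route of record `HCCMUnconditional`; squad F0∕P3c∕LH4; registered stub served:
`F0P3cDyRamFourFrameU2H.stub_U2H_fixedPointCensus_typeTwo_unit0` ((ρ2b′-X), U2H ED. 15 :418) through the typed bottom socket (C) `SOCKET-hOCC.v1` (869d0c15; type RamM).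
ONE abstract dyadic field `K` (= `M`) with the (C) frame of ★ p858394 ∕ ★ p858345 (`ρ, Θ` commuting isometric involutions, `hF4`, the third-field package, the Θ-datum, `hFN`,
the Θ-fixed unit non-norm `n₀`, the Θ unit-norm dichotomy `(c₀, hdich)` and the letter `hf` of Σ1∕Σ2), the S9 letters of Σ3b ★∕p858419 (`λΘλ = 1`, `ρu = u`, `uΘu = 1`, the
normaliser `ν`: `ρν = ν`, `νΘν = 1`, `λρλ = ν²`; `ρω = ω`, `Θω = −ω`; `λ′ := λ∕ν` DEEP: `|λ′ − 1| ≤ R″ := exp(−(2(s0 + 2g − 1) + d_ρ))`), the tokens `|λ − u| = exp(−2m)`,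
`|(λ − u) − ρ(λ − u)| = exp(−(2jl + d_ρ))`, and the scalars `h` (hyperbolic) ∕ `h′` (anisotropic).  With `κ := (λ′ − u′)(1 + λ′)(1 + u′)∕(ω λ′ u′)` (★ p857819) and
**SIDE := `∃ e, ρe = e ∧ e·Θe = κ·ρκ`** (Σ3b turns SIDE into `(β, θ)_v = 1` at the CM place), `sign_law_ramM` proves the five letters of the (C) head at once:
(T) class T of `κ_tw = ρ(λ−u)∕(λ−u)` at `R″` ⇒ SIDE; (E) class E ⇒ ¬SIDE; (P) the regime-B bit of `η_h(k₀)` against `κ_tw` ⇒ SIDE; (M) the bit of `η_{h′}(k₀′)` ⇒ ¬SIDE;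
(W) THE WINDOW `m + s0 + 2g ≤ jl + 1 ⇒ SIDE` (class T at `ω := 1`).
MECHANISM: `κ_tw = ψ(κ)·ρλ′` (Σ3a §1) with `ρλ′` an `R″`-approximant of `1` (Σ3a §2), so the class bits of `κ_tw` are those of `ψ(κ)`; Σ3a §3 (far-cell criterion: `κ ∈ F^×·N_Θ(U)`,
resp. `F^×·n₀·N_Θ(U)`) and `exists_rhoNorm_of_eq_fixed_mul_norm` ∕ `not_exists_rhoNorm_of_eq_fixed_mul_anchored` (via Σ1 ★ p858275).  Regime B: `−η∕κ_tw = ψ(ξ₁·h·N(ϖM^{k₀})∕κ)·λ′`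
(Σ3a `neg_div_twist_eq_map_div_mul`, `ξ₁ := jKπ′ − ρ(jKπ′)`, ★ p858305 `bitLit_iff_twistNear_neg`); class T of that Θ-fixed element plus `hhyper` (`h ∈ ξ₁·F^×·N_Θ(M^×)`) puts `κ` in
`F^×·N_Θ(M^×)`, while `haniso` (`h′ ∈ ξ₁·n₀·F^×·N_Θ(M^×)`, ★ p858188 `norm_or_anchored_of_even`) puts it in `F^×·n₀·N_Θ(M^×)`.  NO parity token.
THEOREMS ONLY (no `def`, no instance, no notation, no `sorry`); lane `--supports stmt-HodgeConjecture-24833 --as helper` (count-neutral).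
HONEST LABEL.  Count-neutral helper; (ρ2b′-X) stays an OPEN prover target; `HC_CM` is proved only modulo the 7 printed citations (2 remaining named inputs: hLiu418 =
`stmt-HodgeConjecture-24832`, h413 = `stmt-HodgeConjecture-24833`) until rung 0 closes.

## References
* [Rogawski1990] J. D. Rogawski, *Automorphic Representations of Unitary Groups in Three Variables*, Ann. of Math. Stud. 123 (1990), §4.9 Prop. 4.9.1 (b) p. 55, Lemma 4.9.3 p. 56.
* [Serre1979] J.-P. Serre, *Local Fields*, GTM 67 (1979), Ch. V §3 Prop. 5 and Cor. 3; Ch. X §1.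
* [LabesseLanglands1979] J.-P. Labesse, R. P. Langlands, *L-indistinguishability for SL(2)*, Canad. J. Math. 31 (1979), §2 (2.1)–(2.2) pp. 7–8.
* [Kottwitz1986BaseChangeUnits] R. E. Kottwitz, *Base change for unit elements of Hecke algebras*, Compositio Math. 60 (1986), §1 pp. 240–241.
-/

set_option autoImplicit false

noncomputable section

open WithZero
open Literature.NumberTheory.Automorphic.UnitaryThreeFourFrame (IsRamifiedQuadraticDatum)
open Literature.NumberTheory.LocalFields.WildQuadraticDatum (v_eq_one_of_v_mul_map_eq_one)
open Summit.HodgeConjecture.HodgeConjecture.Cruxes.H413.F0P3cDyRamToricLevelCensusRamM (bitLit_iff_twistNear_neg)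
open Summit.HodgeConjecture.HodgeConjecture.Cruxes.H413.F0P3cDyRamClassLettersRelative (norm_or_anchored_of_even)
open Summit.HodgeConjecture.HodgeConjecture.Cruxes.H413.F0P3cDyRamClassLettersRamM (div_mul_div_eq_map_mul_div)
open Summit.HodgeConjecture.HodgeConjecture.Cruxes.H413.F0P3cDyRamTokenSignRamK (theta_map_signKappa)
open Summit.HodgeConjecture.HodgeConjecture.Cruxes.H413.F0P3cDyRamSignFarCellRamM
open scoped Valued

namespace Summit.HodgeConjecture.HodgeConjecture.Cruxes.H413.F0P3cDyRamSignLawRamM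

variable {K : Type} [Field K] [Valued K ℤᵐ⁰] {ρ Θ : K →+* K}
variable {K' : Type*} [Field K'] [Valued K' ℤᵐ⁰] {σ' : K' →+* K'} {π' : K'} {d' : ℕ}

/-- `|ρμ∕μ − 1| = exp(2m − 2jl − d_ρ)` from the two tokens (`|μ| = exp(−2m)`, `|μ − ρμ| = exp(−(2jl + d_ρ))`). [cite: Rogawski1990, §4.9 Prop. 4.9.1 (b) p. 55] -/
theorem v_twist_sub_one_eq {μ : K} {m jl dρ : ℕ} (hm : Valued.v μ = exp (-(2 * (m : ℤ)))) (hjl : Valued.v (μ - ρ μ) = exp (-(2 * (jl : ℤ) + dρ))) :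
    Valued.v (ρ μ / μ - 1) = exp (2 * (m : ℤ) - 2 * jl - dρ) := by
  have hμ0 : μ ≠ 0 := fun h0 => by rw [h0, map_zero] at hm; exact (exp_ne_zero hm.symm).elim
  rw [div_sub_one hμ0, map_div₀, Valuation.map_sub_swap, hjl, hm, ← exp_sub]
  congr 1; ring

/-- **THE RamM SIGN LAW, TYPE-FREE** — see the module docstring: the five letters (T)(E)(P)(M)(W) of the (C) head with SIDE := `∃ e, ρe = e ∧ e·Θe = κ·ρκ`.
[cite: Rogawski1990, §4.9 Prop. 4.9.1 (b) p. 55, Lemma 4.9.3 p. 56] [cite: Serre1979, Ch. V §3 Prop. 5 and Cor. 3] [cite: LabesseLanglands1979, §2 (2.1)–(2.2) pp. 7–8]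
[cite: Kottwitz1986BaseChangeUnits, §1 pp. 240–241] -/
theorem sign_law_ramM [CompleteSpace K] [Finite 𝓀[K]]
    (hρρ : ∀ x, ρ (ρ x) = x) (hvρ : ∀ x, Valued.v (ρ x) = Valued.v x) (hΘΘ : ∀ x, Θ (Θ x) = x) (hΘρ : ∀ x, Θ (ρ x) = ρ (Θ x))
    (hvΘ : ∀ x, Valued.v (Θ x) = Valued.v x)
    (hF4 : ∀ f : K, ρ f = f → Θ f = f → f ≠ 0 → ∃ n : ℤ, Valued.v f = exp (4 * n))
    (hσ' : ∀ x, σ' (σ' x) = x) (hvσ' : ∀ x, Valued.v (σ' x) = Valued.v x) (hfix' : ∀ x : K', σ' x = x → x ≠ 0 → ∃ n : ℤ, Valued.v x = exp (2 * n))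
    (hπ' : Valued.v π' = exp (-1 : ℤ)) (hdd' : Valued.v (π' - σ' π') = Valued.v π' ^ d')
    (jK : K' →+* K) (hjle : ∀ x y : K', Valued.v (jK x) ≤ Valued.v (jK y) ↔ Valued.v x ≤ Valued.v y) (hjΘ : ∀ x, Θ (jK x) = jK x)
    (hjfix : ∀ z : K, Θ z = z → ∃ x, jK x = z) (hjσ : ∀ x, jK (σ' x) = ρ (jK x)) (hjπ : Valued.v (jK π') = exp (-2 : ℤ))
    {ϖ : K} {dΘ tΘ : ℕ} (hDΘ : IsRamifiedQuadraticDatum Θ ϖ dΘ tΘ)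
    (hFN : ∀ f : K, ρ f = f → Θ f = f → Valued.v f = 1 → ∃ x : K, x * Θ x = f)
    {n₀ : K} (hΘn₀ : Θ n₀ = n₀) (hn₀1 : Valued.v n₀ = 1) (hn₀N : ¬ ∃ z : K, z * Θ z = n₀)
    {c₀ : K} (hc₀ : Valued.v c₀ = 1) (hdich : ∀ u : K, Θ u = u → Valued.v u = 1 → (∃ z : K, z * Θ z = u) ∨ ∃ z : K, z * Θ z = c₀ * u)
    (hf : ∃ a : K, Θ a = a ∧ Valued.v a = 1 ∧ ¬ ∃ e : K, ρ e = e ∧ e * Θ e = a * ρ a)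
    {ϖM : K} (hϖM : Valued.v ϖM = exp (-1 : ℤ))
    {dρ g s0 : ℕ} (hg : dΘ = 2 * g) (hds : 2 * d' = dρ + 2 * s0) (hg1 : 1 ≤ g)
    {lam u ν ω : K} (hlamΘ : lam * Θ lam = 1) (hu : ρ u = u) (hu1 : u * Θ u = 1) (hρν : ρ ν = ν) (hνΘ : ν * Θ ν = 1) (hdet : lam * ρ lam = ν ^ 2)
    (hρω : ρ ω = ω) (hΘω : Θ ω = -ω) (hω0 : ω ≠ 0)
    (hdeep : Valued.v (lam / ν - 1) ≤ exp (-(2 * ((s0 : ℤ) + 2 * g - 1) + dρ)))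
    (h1lam : 1 + lam / ν ≠ 0) (h1u : 1 + u / ν ≠ 0) (hne : lam / ν - u / ν ≠ 0)
    {m jl : ℕ} (hm : Valued.v (lam - u) = exp (-(2 * (m : ℤ)))) (hjl : Valued.v ((lam - u) - ρ (lam - u)) = exp (-(2 * (jl : ℤ) + dρ)))
    {h h' : K} (hΘh : Θ h = h) (hh : h ≠ 0) (hhyper : ∃ x : K, x ≠ 0 ∧ h * Θ x * x + ρ (h * Θ x * x) = 0)
    (hΘh' : Θ h' = h') (hh' : h' ≠ 0) (haniso : ¬ ∃ x : K, x ≠ 0 ∧ h' * Θ x * x + ρ (h' * Θ x * x) = 0)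
    (k₀ k₀' : ℤ) :
    ((∃ ω₁ : K, Valued.v ω₁ = 1 ∧ Valued.v (ρ (lam - u) / (lam - u) * (ρ (ω₁ * Θ ω₁) / (ω₁ * Θ ω₁)) - 1) ≤ exp (-(2 * ((s0 : ℤ) + 2 * g - 1) + dρ))) →
      ∃ e : K, ρ e = e ∧ e * Θ e =
        (lam / ν - u / ν) * (1 + lam / ν) * (1 + u / ν) / (ω * (lam / ν) * (u / ν)) * ρ ((lam / ν - u / ν) * (1 + lam / ν) * (1 + u / ν) / (ω * (lam / ν) * (u / ν)))) ∧
    ((∃ ω₁ : K, Valued.v ω₁ = 1 ∧ Valued.v (ρ (lam - u) / (lam - u) * (ρ n₀ / n₀) * (ρ (ω₁ * Θ ω₁) / (ω₁ * Θ ω₁)) - 1) ≤ exp (-(2 * ((s0 : ℤ) + 2 * g - 1) + dρ))) →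
      ¬ ∃ e : K, ρ e = e ∧ e * Θ e =
        (lam / ν - u / ν) * (1 + lam / ν) * (1 + u / ν) / (ω * (lam / ν) * (u / ν)) * ρ ((lam / ν - u / ν) * (1 + lam / ν) * (1 + u / ν) / (ω * (lam / ν) * (u / ν)))) ∧
    ((∃ ω₁ : Kˣ, Valued.v (ω₁ : K) = 1 ∧
        Valued.v (1 + ρ h / h * (ρ (ϖM ^ k₀ * Θ (ϖM ^ k₀)) / (ϖM ^ k₀ * Θ (ϖM ^ k₀))) / (ρ (lam - u) / (lam - u)) * (ρ ((ω₁ : K) * Θ ω₁) / ((ω₁ : K) * Θ ω₁))) ≤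
          exp (-(2 * ((s0 : ℤ) + 2 * g - 1) + dρ))) →
      ∃ e : K, ρ e = e ∧ e * Θ e =
        (lam / ν - u / ν) * (1 + lam / ν) * (1 + u / ν) / (ω * (lam / ν) * (u / ν)) * ρ ((lam / ν - u / ν) * (1 + lam / ν) * (1 + u / ν) / (ω * (lam / ν) * (u / ν)))) ∧
    ((∃ ω₁ : Kˣ, Valued.v (ω₁ : K) = 1 ∧
        Valued.v (1 + ρ h' / h' * (ρ (ϖM ^ k₀' * Θ (ϖM ^ k₀')) / (ϖM ^ k₀' * Θ (ϖM ^ k₀'))) / (ρ (lam - u) / (lam - u)) * (ρ ((ω₁ : K) * Θ ω₁) / ((ω₁ : K) * Θ ω₁))) ≤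
          exp (-(2 * ((s0 : ℤ) + 2 * g - 1) + dρ))) →
      ¬ ∃ e : K, ρ e = e ∧ e * Θ e =
        (lam / ν - u / ν) * (1 + lam / ν) * (1 + u / ν) / (ω * (lam / ν) * (u / ν)) * ρ ((lam / ν - u / ν) * (1 + lam / ν) * (1 + u / ν) / (ω * (lam / ν) * (u / ν)))) ∧
    (m + s0 + 2 * g ≤ jl + 1 →
      ∃ e : K, ρ e = e ∧ e * Θ e =
        (lam / ν - u / ν) * (1 + lam / ν) * (1 + u / ν) / (ω * (lam / ν) * (u / ν)) * ρ ((lam / ν - u / ν) * (1 + lam / ν) * (1 + u / ν) / (ω * (lam / ν) * (u / ν)))) := by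
  have hevΘ := hDΘ.2.2.2.1
  -- ### the S9 letters
  have hν0 : ν ≠ 0 := fun h0 => by rw [h0, zero_mul] at hνΘ; exact zero_ne_one hνΘ
  have hlamΘ' : lam / ν * Θ (lam / ν) = 1 := by rw [map_div₀, div_mul_div_comm, hlamΘ, hνΘ, div_one]
  have hlamρ' : lam / ν * ρ (lam / ν) = 1 := by rw [map_div₀, hρν, div_mul_div_comm, hdet, sq, div_self (mul_ne_zero hν0 hν0)]
  have hρu' : ρ (u / ν) = u / ν := by rw [map_div₀, hu, hρν]
  have hu1' : u / ν * Θ (u / ν) = 1 := by rw [map_div₀, div_mul_div_comm, hu1, hνΘ, div_one]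
  have hlam'0 : lam / ν ≠ 0 := fun h0 => by rw [h0, zero_mul] at hlamρ'; exact zero_ne_one hlamρ'
  have hu'0 : u / ν ≠ 0 := fun h0 => by rw [h0, zero_mul] at hu1'; exact zero_ne_one hu1'
  set κ : K := (lam / ν - u / ν) * (1 + lam / ν) * (1 + u / ν) / (ω * (lam / ν) * (u / ν)) with hκdef
  have hΘκ : Θ κ = κ := theta_map_signKappa hlamΘ' hu1' hΘω
  have hκ0 : κ ≠ 0 := div_ne_zero (mul_ne_zero (mul_ne_zero hne h1lam) h1u) (mul_ne_zero (mul_ne_zero hω0 hlam'0) hu'0)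
  have hρκ0 : ρ κ ≠ 0 := (map_ne_zero ρ).2 hκ0
  -- ### the twist factorisation `ρμ∕μ = ψ(κ)·ρλ′`, and `l := ρλ′`, `λ′` are `R″`-approximants of `1`
  have htwist : ρ (lam - u) / (lam - u) = ρ κ / κ * ρ (lam / ν) := by
    rw [twist_eq_twist_div (lam := lam) (u := u) hρν hν0]
    exact twist_eq_map_signKappa_div_mul hlamρ' hρu' hu1' hρω hω0 h1lam h1u hne
  have hρlam' : ρ (lam / ν) = (lam / ν)⁻¹ := eq_inv_of_mul_eq_one_right hlamρ'
  have htwB : ρ (lam - u) / (lam - u) = ρ κ / κ * (lam / ν)⁻¹ := by rw [htwist, hρlam']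
  have hlv : Valued.v (lam / ν) = 1 := v_eq_one_of_v_mul_map_eq_one hvρ (by rw [hlamρ']; exact Valuation.map_one _)
  have hρlv : Valued.v (ρ (lam / ν)) = 1 := by rw [hvρ, hlv]
  have hR := v_jK_pow_far_eq jK hjπ hg hds hg1
  have hdeepl : Valued.v (lam / ν - 1) ≤ Valued.v (jK π' ^ (d' + (dΘ - 1))) := by rw [hR]; exact hdeep
  have hdeepρl : Valued.v (ρ (lam / ν) - 1) ≤ Valued.v (jK π' ^ (d' + (dΘ - 1))) := by
    rw [← map_one ρ, ← map_sub, hvρ]; exact hdeepl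
  -- ### the Θ-fixed ρ-anti-fixed `ξ₁ := jKπ′ − ρ(jKπ′)` of the package
  have hdP := v_thirdFieldUniformizer_sub_map hdd' jK hjle hjσ hjπ
  have hξ0 : jK π' - ρ (jK π') ≠ 0 := fun h0 => by rw [h0, map_zero] at hdP; exact (exp_ne_zero hdP.symm).elim
  have hΘξ : Θ (jK π' - ρ (jK π')) = jK π' - ρ (jK π') := by rw [map_sub, hΘρ, hjΘ]
  have hρξ : ρ (jK π' - ρ (jK π')) = -(jK π' - ρ (jK π')) := by rw [map_sub, hρρ, neg_sub]
  refine ⟨?_, ?_, ?_, ?_, ?_⟩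
  · ---------------------------------------------------------------- (T) class T of `κ_tw` ⇒ SIDE
    rintro ⟨ω₁, hω₁, hle⟩
    rw [← hR] at hle
    have hT := (exists_twistNear_iff_of_near_factor (ρ := ρ) (Θ := Θ) htwist hρlv hdeepρl).1 ⟨ω₁, hω₁, hle⟩
    exact exists_rhoNorm_of_twistNear_far hρρ hvρ hΘρ hvΘ hF4 hσ' hvσ' hfix' hπ' hdd' jK hjle hjΘ hjfix hjσ hjπ hDΘ hFN hΘn₀ hn₀1 hn₀N hΘκ hκ0 hT
  · ---------------------------------------------------------------- (E) class E ⇒ ¬SIDE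
    rintro ⟨ω₁, hω₁, hle⟩
    rw [← hR] at hle
    have hE := (exists_anchoredNear_iff_of_near_factor (ρ := ρ) (Θ := Θ) (n₀ := n₀) htwist hρlv hdeepρl).1 ⟨ω₁, hω₁, hle⟩
    exact not_exists_rhoNorm_of_anchoredNear_far hρρ hvρ hΘρ hvΘ hF4 hσ' hvσ' hfix' hπ' hdd' jK hjle hjΘ hjfix hjσ hjπ hDΘ hFN hΘn₀ hn₀1 hn₀N
      hc₀ hdich hf hΘκ hκ0 hE
  · ---------------------------------------------------------------- (P) the regime-B bit of `η_h(k₀)` ⇒ SIDE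
    intro hB
    have hϖ0 : ϖM ≠ 0 := fun h0 => by rw [h0, map_zero] at hϖM; exact (exp_ne_zero hϖM.symm).elim
    have hNα0 : ϖM ^ k₀ * Θ (ϖM ^ k₀) ≠ 0 := mul_ne_zero (zpow_ne_zero _ hϖ0) ((map_ne_zero Θ).2 (zpow_ne_zero _ hϖ0))
    have hΘNα : Θ (ϖM ^ k₀ * Θ (ϖM ^ k₀)) = ϖM ^ k₀ * Θ (ϖM ^ k₀) := by rw [map_mul, hΘΘ, mul_comm]
    have hB' := (bitLit_iff_twistNear_neg (ρ := ρ) (Θ := Θ) (η := ρ h / h * (ρ (ϖM ^ k₀ * Θ (ϖM ^ k₀)) / (ϖM ^ k₀ * Θ (ϖM ^ k₀))))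
      (κ := ρ (lam - u) / (lam - u)) (exp (-(2 * ((s0 : ℤ) + 2 * g - 1) + dρ)))).1 hB
    rw [neg_div_twist_eq_map_div_mul (ρ := ρ) hh hNα0 hκ0 hρκ0 hξ0 hlam'0 hρξ htwB, ← hR] at hB'
    -- class T of `ψ(y)`, `y := ξ₁·h·N(ϖM^{k₀})∕κ`
    set y : K := (jK π' - ρ (jK π')) * h * (ϖM ^ k₀ * Θ (ϖM ^ k₀)) / κ with hydef
    have hΘy : Θ y = y := by rw [hydef, map_div₀, map_mul, map_mul, hΘξ, hΘh, hΘNα, hΘκ]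
    have hy0 : y ≠ 0 := div_ne_zero (mul_ne_zero (mul_ne_zero hξ0 hh) hNα0) hκ0
    have hT := (exists_twistNear_iff_of_near_factor (ρ := ρ) (Θ := Θ) (κ := ρ y / y * (lam / ν)) rfl hlv hdeepl).1 hB'
    obtain ⟨f, x, hρf, hΘf, hf0, hx1, hyx⟩ := exists_fixed_mul_norm_of_twistNear_far hρρ hvρ hΘρ hvΘ hF4 hσ' hvσ' hfix' hπ' hdd' jK hjle hjΘ hjfix hjσ hjπ
      hDΘ hFN hΘn₀ hn₀1 hn₀N hΘy hy0 hT
    have hx0 : x ≠ 0 := fun h0 => by rw [h0, map_zero] at hx1; exact zero_ne_one hx1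
    -- `hhyper`: `a := h·Θz·z` is ρ-anti-fixed, so `F₀ := ξ₁·a∕f` is doubly fixed and `κ = F₀·N(ϖM^{k₀}∕(z·x))`
    obtain ⟨z, hz0, hz⟩ := hhyper
    have hΘz0 : Θ z ≠ 0 := (map_ne_zero Θ).2 hz0
    have hΘx0 : Θ x ≠ 0 := (map_ne_zero Θ).2 hx0
    have hρa : ρ (h * Θ z * z) = -(h * Θ z * z) := (neg_eq_of_add_eq_zero_right hz).symm
    have hΘa : Θ (h * Θ z * z) = h * Θ z * z := by rw [map_mul, map_mul, hΘh, hΘΘ]; ring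
    have hρF : ρ ((jK π' - ρ (jK π')) * (h * Θ z * z) / f) = (jK π' - ρ (jK π')) * (h * Θ z * z) / f := by
      rw [map_div₀, map_mul, hρξ, hρa, hρf, neg_mul_neg]
    have hΘF : Θ ((jK π' - ρ (jK π')) * (h * Θ z * z) / f) = (jK π' - ρ (jK π')) * (h * Θ z * z) / f := by
      rw [map_div₀, map_mul, hΘξ, hΘa, hΘf]
    have hϖk0 : ϖM ^ k₀ ≠ 0 := zpow_ne_zero _ hϖ0
    have hΘϖk0 : Θ (ϖM ^ k₀) ≠ 0 := (map_ne_zero Θ).2 hϖk0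
    have hκeq : κ = (jK π' - ρ (jK π')) * (h * Θ z * z) / f * (ϖM ^ k₀ / (z * x) * Θ (ϖM ^ k₀ / (z * x))) := by
      have e1 : κ = (jK π' - ρ (jK π')) * h * (ϖM ^ k₀ * Θ (ϖM ^ k₀)) / (f * (x * Θ x)) := by
        rw [← hyx, hydef]; field_simp
      rw [e1, map_div₀, map_mul]
      field_simp
    exact exists_rhoNorm_of_eq_fixed_mul_norm hρρ hΘρ hρF hΘF hκeq
  · ---------------------------------------------------------------- (M) the regime-B bit of `η_{h′}(k₀′)` ⇒ ¬SIDE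
    intro hB
    have hϖ0 : ϖM ≠ 0 := fun h0 => by rw [h0, map_zero] at hϖM; exact (exp_ne_zero hϖM.symm).elim
    have hNα0 : ϖM ^ k₀' * Θ (ϖM ^ k₀') ≠ 0 := mul_ne_zero (zpow_ne_zero _ hϖ0) ((map_ne_zero Θ).2 (zpow_ne_zero _ hϖ0))
    have hΘNα : Θ (ϖM ^ k₀' * Θ (ϖM ^ k₀')) = ϖM ^ k₀' * Θ (ϖM ^ k₀') := by rw [map_mul, hΘΘ, mul_comm]
    have hB' := (bitLit_iff_twistNear_neg (ρ := ρ) (Θ := Θ) (η := ρ h' / h' * (ρ (ϖM ^ k₀' * Θ (ϖM ^ k₀')) / (ϖM ^ k₀' * Θ (ϖM ^ k₀'))))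
      (κ := ρ (lam - u) / (lam - u)) (exp (-(2 * ((s0 : ℤ) + 2 * g - 1) + dρ)))).1 hB
    rw [neg_div_twist_eq_map_div_mul (ρ := ρ) hh' hNα0 hκ0 hρκ0 hξ0 hlam'0 hρξ htwB, ← hR] at hB'
    set y : K := (jK π' - ρ (jK π')) * h' * (ϖM ^ k₀' * Θ (ϖM ^ k₀')) / κ with hydef
    have hΘy : Θ y = y := by rw [hydef, map_div₀, map_mul, map_mul, hΘξ, hΘh', hΘNα, hΘκ]
    have hy0 : y ≠ 0 := div_ne_zero (mul_ne_zero (mul_ne_zero hξ0 hh') hNα0) hκ0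
    have hT := (exists_twistNear_iff_of_near_factor (ρ := ρ) (Θ := Θ) (κ := ρ y / y * (lam / ν)) rfl hlv hdeepl).1 hB'
    obtain ⟨f, x, hρf, hΘf, hf0, hx1, hyx⟩ := exists_fixed_mul_norm_of_twistNear_far hρρ hvρ hΘρ hvΘ hF4 hσ' hvσ' hfix' hπ' hdd' jK hjle hjΘ hjfix hjσ hjπ
      hDΘ hFN hΘn₀ hn₀1 hn₀N hΘy hy0 hT
    have hx0 : x ≠ 0 := fun h0 => by rw [h0, map_zero] at hx1; exact zero_ne_one hx1
    -- `haniso`: `h′∕ξ₁` is Θ-fixed of even order and NOT a Θ-norm, hence `= N_Θ(z)·n₀` (★ p858188)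
    have hn₀0 : n₀ ≠ 0 := fun h0 => by rw [h0, map_zero] at hn₀1; exact zero_ne_one hn₀1
    have hΘg : Θ (h' / (jK π' - ρ (jK π'))) = h' / (jK π' - ρ (jK π')) := by rw [map_div₀, hΘh', hΘξ]
    have hg0 : h' / (jK π' - ρ (jK π')) ≠ 0 := div_ne_zero hh' hξ0
    obtain ⟨a, ha⟩ := hevΘ h' hΘh' hh'
    have hvg : Valued.v (h' / (jK π' - ρ (jK π'))) = exp (2 * (a + d')) := by
      rw [map_div₀, ha, hdP, ← exp_sub]; congr 1; ring
    obtain ⟨z, hz⟩ : ∃ z : K, z * Θ z * n₀ = h' / (jK π' - ρ (jK π')) := by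
      rcases norm_or_anchored_of_even hΘΘ hvΘ hc₀ hdich hΘn₀ hn₀1 hn₀N hϖM hΘg hvg with ⟨z, hz⟩ | ⟨z, hz⟩
      · exfalso
        have hz0 : z ≠ 0 := fun h0 => hg0 (by rw [← hz, h0, zero_mul])
        have hΘz0 : Θ z ≠ 0 := (map_ne_zero Θ).2 hz0
        apply haniso
        refine ⟨z⁻¹, inv_ne_zero hz0, ?_⟩
        have h1 : h' * Θ z⁻¹ * z⁻¹ = jK π' - ρ (jK π') := by
          rw [show h' = (jK π' - ρ (jK π')) * (z * Θ z) by rw [hz, mul_div_cancel₀ _ hξ0], map_inv₀]; field_simp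
        rw [h1, hρξ, add_neg_cancel]
      · exact ⟨z, hz⟩
    have hz0 : z ≠ 0 := fun h0 => hg0 (by rw [← hz, h0, zero_mul, zero_mul])
    have hΘz0 : Θ z ≠ 0 := (map_ne_zero Θ).2 hz0
    have hΘx0 : Θ x ≠ 0 := (map_ne_zero Θ).2 hx0
    have hh'eq : h' = (jK π' - ρ (jK π')) * n₀ * (z * Θ z) := by
      rw [show (jK π' - ρ (jK π')) * n₀ * (z * Θ z) = (jK π' - ρ (jK π')) * (z * Θ z * n₀) by ring, hz, mul_div_cancel₀ _ hξ0]
    -- `κ = (ξ₁²∕f)·n₀·N(z·ϖM^{k₀′}∕x)`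
    have hρF : ρ ((jK π' - ρ (jK π')) ^ 2 / f) = (jK π' - ρ (jK π')) ^ 2 / f := by rw [map_div₀, map_pow, hρξ, neg_sq, hρf]
    have hΘF : Θ ((jK π' - ρ (jK π')) ^ 2 / f) = (jK π' - ρ (jK π')) ^ 2 / f := by rw [map_div₀, map_pow, hΘξ, hΘf]
    have hF0 : (jK π' - ρ (jK π')) ^ 2 / f ≠ 0 := div_ne_zero (pow_ne_zero 2 hξ0) hf0
    have hw0 : z * ϖM ^ k₀' / x ≠ 0 := div_ne_zero (mul_ne_zero hz0 (zpow_ne_zero _ hϖ0)) hx0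
    have hϖk0 : ϖM ^ k₀' ≠ 0 := zpow_ne_zero _ hϖ0
    have hΘϖk0 : Θ (ϖM ^ k₀') ≠ 0 := (map_ne_zero Θ).2 hϖk0
    have hκeq : κ = (jK π' - ρ (jK π')) ^ 2 / f * n₀ * (z * ϖM ^ k₀' / x * Θ (z * ϖM ^ k₀' / x)) := by
      have e1 : κ = (jK π' - ρ (jK π')) * h' * (ϖM ^ k₀' * Θ (ϖM ^ k₀')) / (f * (x * Θ x)) := by
        rw [← hyx, hydef]; field_simp
      rw [e1, hh'eq, map_div₀, map_mul]
      field_simp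
    exact not_exists_rhoNorm_of_eq_fixed_mul_anchored hρρ hΘΘ hΘρ hvρ hvΘ hF4 hFN hevΘ hΘn₀ hn₀N hc₀ hdich hf hϖM hρF hΘF hF0 hw0 hκ0 hκeq
  · ---------------------------------------------------------------- (W) the window: deep `jl` puts `κ_tw` itself within `R″` (class T at `ω := 1`)
    intro hwin
    have hμ1 : Valued.v (ρ (lam - u) / (lam - u) * (ρ (1 * Θ 1) / (1 * Θ 1)) - 1) ≤ Valued.v (jK π' ^ (d' + (dΘ - 1))) := by
      rw [map_one, one_mul, map_one, div_one, mul_one, v_twist_sub_one_eq hm hjl, hR, exp_le_exp]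
      omega
    have hT := (exists_twistNear_iff_of_near_factor (ρ := ρ) (Θ := Θ) htwist hρlv hdeepρl).1 ⟨1, Valuation.map_one _, hμ1⟩
    exact exists_rhoNorm_of_twistNear_far hρρ hvρ hΘρ hvΘ hF4 hσ' hvσ' hfix' hπ' hdd' jK hjle hjΘ hjfix hjσ hjπ hDΘ hFN hΘn₀ hn₀1 hn₀N hΘκ hκ0 hT

end Summit.HodgeConjecture.HodgeConjecture.Cruxes.H413.F0P3cDyRamSignLawRamM

end
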